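import Summits.Ventures.Crystal3D.Theorems.StickyWulffConstantTextureBuildHalfDefect
import HarnessLib

/-!
# TB-1 brick: the NET SLACK of unowned junk — half its bonds to owned balls minus its own half-defects, ball by ball
# (lane T, crux `TextureLiminfV5`, stmt-Ventures-23912; memo HOME/wulff-p2/g24/HEAL-g24.md §2b «drop small grains»)

HONEST FRAMING. Venture `Summits/Ventures/Crystal3D` (cell `crystal3d-full`), route `route-Ventures-StickyWulffConstant`, helper `--supports` the
law-v5 crux `TextureLiminfV5` (stmt-Ventures-23912).  Pure finite combinatorics over '…TextureBuildHalfDefect' (census-free, standard axioms).  Nothing about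
any cover or texture is claimed; F-C1 not moved.

WHY.  In the TB-cover's slack inequality `tilingLoss₂ + rimSum + gapCost ≤ θ·N^{2/3} + unownedSlack₃`, a ball that NO piece owns (junk: a dropped small grain,
a whisker left standing, healed-out material's neighbours…) is DEBITED through the rims of the pieces it touches — `½` per bond to an owned ball
(`tentRimSharp`'s `½·crossCount (owned) (X' ∖ Xh)`, the cells' `tilingRim`) — and CREDITED its own half-defect through `unownedSlack₃`.  This file is the
exact per-ball net, independent of the cover structures:

* **`half_crossCount_sub_sum_halfDefect_eq`** — for `O ⊆ X'` (owned) and `J` disjoint from `O` (junk): `½·cross(O, J) − Σ_{a ∈ J} halfDefect_{X'} a =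
  ½·Σ_{a ∈ J} (2·cdeg_O a + cdeg_{X' ∖ O} a − 12)`;
* `half_crossCount_le_sum_halfDefect` — hence junk whose every ball has `2·(owned contacts) + (other contacts) ≤ 12` costs NOTHING net (its debit is covered by
  its credit): e.g. a dropped grain with an incoherent interface (`≤ 1` exact contact with owned balls per interface ball, `≤ 10` others), memo §2b; a hollow-
  seated (coherent) interface ball (`3` owned contacts, `9` others) nets `+3/2` — the coherent case belongs to the riser machinery, not to dropping.
-/

noncomputable section

namespace Summit.Ventures.Crystal3D.Theorems

open Finset Summit.Ventures.Crystal3D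
open Summit.Ventures.Crystal3D.Cruxes.TextureLiminf.TexShadow (E3)

/-- **NET SLACK OF JUNK, exactly**: `½·cross(O, J) − Σ_{a∈J} halfDefect_{X'} a = ½·Σ_{a∈J} (2·cdeg_O a + cdeg_{X'∖O} a − 12)` for `O ⊆ X'`. -/
theorem half_crossCount_sub_sum_halfDefect_eq {O J X' : Finset E3} (hO : O ⊆ X') :
    (crossCount O J : ℝ) / 2 - ∑ a ∈ J, halfDefect X' a =
      (∑ a ∈ J, (2 * (cdeg O a : ℝ) + (cdeg (X' \ O) a : ℝ) - 12)) / 2 := by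
  classical
  rw [crossCount_comm, crossCount_eq_sum, Nat.cast_sum]
  have hsplit : ∀ a, (cdeg X' a : ℝ) = (cdeg O a : ℝ) + (cdeg (X' \ O) a : ℝ) := fun a => by
    exact_mod_cast cdeg_eq_add_sdiff hO a
  have hhd : ∑ a ∈ J, halfDefect X' a = ∑ a ∈ J, (((12 : ℝ) - ((cdeg O a : ℝ) + (cdeg (X' \ O) a : ℝ))) / 2) := by
    refine Finset.sum_congr rfl fun a _ => ?_
    unfold halfDefect; rw [hsplit a]
  rw [hhd, Finset.sum_div, Finset.sum_div, ← Finset.sum_sub_distrib]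
  refine Finset.sum_congr rfl fun a _ => ?_
  have : (((O.filter fun q => dist a q = 1).card : ℕ) : ℝ) = (cdeg O a : ℝ) := rfl
  rw [this]
  ring

/-- **Junk with few owned contacts is free**: if every junk ball `a ∈ J` has `2·cdeg_O a + cdeg_{X'∖O} a ≤ 12`, then `½·cross(O, J) ≤ Σ_{a∈J} halfDefect_{X'} a`. -/
theorem half_crossCount_le_sum_halfDefect {O J X' : Finset E3} (hO : O ⊆ X')
    (hJ : ∀ a ∈ J, 2 * cdeg O a + cdeg (X' \ O) a ≤ 12) :
    (crossCount O J : ℝ) / 2 ≤ ∑ a ∈ J, halfDefect X' a := by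
  have h := half_crossCount_sub_sum_halfDefect_eq (J := J) hO
  have hle : (∑ a ∈ J, (2 * (cdeg O a : ℝ) + (cdeg (X' \ O) a : ℝ) - 12)) / 2 ≤ 0 := by
    have : ∑ a ∈ J, (2 * (cdeg O a : ℝ) + (cdeg (X' \ O) a : ℝ) - 12) ≤ 0 :=
      Finset.sum_nonpos fun a ha => by
        have : (2 * (cdeg O a : ℝ) + (cdeg (X' \ O) a : ℝ)) ≤ 12 := by exact_mod_cast hJ a ha
        linarith
    linarith
  linarith

/-- The kissing bound caps the net debit of any junk ball at `+6`: `2·cdeg_O a + cdeg_{X'∖O} a − 12 ≤ cdeg_O a ≤ 12` in a packing. -/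
theorem two_mul_cdeg_add_cdeg_sub_le {O X' : Finset E3} (hO : O ⊆ X') (hX : ∀ p ∈ X', ∀ q ∈ X', p ≠ q → 1 ≤ dist p q) (a : E3) :
    2 * (cdeg O a : ℝ) + (cdeg (X' \ O) a : ℝ) - 12 ≤ (cdeg O a : ℝ) := by
  have h12 : (cdeg X' a : ℝ) ≤ 12 := by exact_mod_cast cdeg_le_twelve X' hX a
  have hsplit : (cdeg X' a : ℝ) = (cdeg O a : ℝ) + (cdeg (X' \ O) a : ℝ) := by exact_mod_cast cdeg_eq_add_sdiff hO a
  linarith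

end Summit.Ventures.Crystal3D.Theorems

end
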